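import Mathlib
import HarnessLib
import Summits.HubbardSuperconductivity.HubbardSuperconductivity.Theorems.ChiralWindowCwKLChiralWindowChannelOps
import Summits.HubbardSuperconductivity.HubbardSuperconductivity.Theorems.ChiralWindowCwKLChiralWindowFrameHS
import Summits.HubbardSuperconductivity.HubbardSuperconductivity.Theorems.ChiralWindowCwKLChiralWindowMeanZero
import Summits.HubbardSuperconductivity.HubbardSuperconductivity.Theorems.ChiralWindowCwKLChiralWindowBottomStates
import Summits.HubbardSuperconductivity.HubbardSuperconductivity.Theorems.ChiralWindowCwKLChiralWindowChannelBound
import Literature.Analysis.OperatorTheory.TempleCertificateResidual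
import Literature.Analysis.OperatorTheory.CompactCompression
import Literature.MathematicalPhysics.QuantumLattice.KohnLuttingerChannelStates

/-!
# Crux `CwKLChiralWindow` (stmt-1741), line `Sketch`: certified bounds for one channel bottom, RESIDUAL form

Residual-form variant of `…ChannelBound`.  For `μ ∈ (-4,0)`, a channel `χ`, the base kernel `κ = [withU] + χ₀(k+k')`,
a trial channel function `Φ ∈ L²(σ_μ)` and an admissible deflation, given ENCLOSURES (real numbers `ρlo, ρhi, et, h, β`
and a shift `s`) of the explicit integrals

`N = ∫Φ²`, `Q = ∫ Φ (∫ κ Φ)`, `R_s = ∫ (∫ κ Φ - s Φ)²`, `H = ∫∫ (K_χ - Σ c u⊗u)²`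

in the form `ρlo·N ≤ Q ≤ ρhi·N`, `ρhi < 0`, `R_s ≤ et·N` (RESIDUAL bound, any real shift `s`), `H ≤ h`, `β ≤ 0`,
`h - d ρhi² ≤ β²` (`d = 2` for `E`, else `1`), `ρhi < β`: the channel bottom obeys
`min g(ρlo) g(ρhi) ≤ channelInf ε₀ μ 1 χ ≤ ρhi`, `g(ρ) = (βρ - ρ² - et)/(β - ρ)` (the upper bound unless `χ = A1g` without
the bare-`U` term) — `stub_klChannelBoundR`.  The proof is that of `…ChannelBound` (compression of the operator package of
`…ChannelOps` to the sector `V = ker (1 - P)`, `Literature…CompactCompression`), with `Literature…temple_certificate_residual`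
in place of `temple_certificate`: the residual `‖T x - s x‖²` of the normalised trial `x = Φ/√N` is `R_s / N ≤ et`.
`kl_cbr_setup` keeps the whole package (operators, compression, trial vector, bottom eigenvalue with Temple/Kato/multiplicity
data, Kato now in the form `‖x - v‖² ≤ et/(β - ρhi)²`) for the residual node-covering file.  The `α`-free dictionary
lemmas `kl_cb_*` of `…ChannelBound` are reused.
-/

noncomputable section

set_option linter.dupNamespace false

namespace Summit.HubbardSuperconductivity.HubbardSuperconductivity.Theorems

open MeasureTheory Literature.MathematicalPhysics.QuantumLattice Literature.Analysis.OperatorTheory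

/-! ### The setup: compression, trial vector, Temple -/

set_option maxHeartbeats 800000 in
/-- **The certified channel package, residual form.** Operators `A, P, U₁` of `…ChannelOps`, the compression `T` of
`A` to `V = ker (1 - P)`, the normalised trial vector `x = Φ/√N ∈ V`, and the bottom eigenvalue `l` of `T` with the
conclusions of `temple_certificate_residual` (Ritz `l ≤ ρhi`, Temple `min g ≤ l` with `g(ρ) = (βρ - ρ² - et)/(β - ρ)`,
Rayleigh `≥ l`, gap `β`, Kato enclosure `‖x - v‖² ≤ et/(β - ρhi)²`, multiplicity mass). [folklore] -/
theorem kl_cbr_setup {μ : ℝ} (hμ : μ ∈ Set.Ioo (-4 : ℝ) 0) (χ : D4Irrep) (withU : Bool)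
    (hU : withU = true → χ = D4Irrep.A1g) {M : ℕ} {c : Fin M → ℝ} {u : Fin M → Momentum → ℝ}
    (hu : ∀ m, MemLp (u m) 2 (fermiCurveMeasure (squareDispersion 1 0) μ)) (hc : ∀ m, 0 ≤ c m)
    {Φ : Momentum → ℝ} (hΦ : MemLp Φ 2 (fermiCurveMeasure (squareDispersion 1 0) μ)) (hΦch : InChannel χ Φ)
    {ρlo ρhi et h β s : ℝ}
    (hN : 0 < ∫ k, Φ k ^ 2 ∂fermiCurveMeasure (squareDispersion 1 0) μ)
    (hρlo : ρlo * ∫ k, Φ k ^ 2 ∂fermiCurveMeasure (squareDispersion 1 0) μ ≤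
      ∫ k, Φ k * ∫ k', ((if withU then 1 else 0) + lindhardFunction (squareDispersion 1 0) μ (k + k')) * Φ k'
        ∂fermiCurveMeasure (squareDispersion 1 0) μ ∂fermiCurveMeasure (squareDispersion 1 0) μ)
    (hρhi : ∫ k, Φ k * ∫ k', ((if withU then 1 else 0) + lindhardFunction (squareDispersion 1 0) μ (k + k')) * Φ k'
        ∂fermiCurveMeasure (squareDispersion 1 0) μ ∂fermiCurveMeasure (squareDispersion 1 0) μ ≤
      ρhi * ∫ k, Φ k ^ 2 ∂fermiCurveMeasure (squareDispersion 1 0) μ)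
    (hρhi0 : ρhi < 0)
    (hres : ∫ k, (∫ k', ((if withU then 1 else 0) + lindhardFunction (squareDispersion 1 0) μ (k + k')) * Φ k'
        ∂fermiCurveMeasure (squareDispersion 1 0) μ - s * Φ k) ^ 2 ∂fermiCurveMeasure (squareDispersion 1 0) μ ≤
      et * ∫ k, Φ k ^ 2 ∂fermiCurveMeasure (squareDispersion 1 0) μ)
    (hH : ∫ z, (d4Project χ (fun q => (if withU then 1 else 0) + lindhardFunction (squareDispersion 1 0) μ (z.1 + q)) z.2 -
        ∑ m, c m * (u m z.1 * u m z.2)) ^ 2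
        ∂(fermiCurveMeasure (squareDispersion 1 0) μ).prod (fermiCurveMeasure (squareDispersion 1 0) μ) ≤ h)
    (hβ0 : β ≤ 0) (hβ : h - (if χ = D4Irrep.E then 2 else 1) * ρhi ^ 2 ≤ β ^ 2) (hρβ : ρhi < β) :
    ∃ (A P U₁ : Lp ℝ 2 (fermiCurveMeasure (squareDispersion 1 0) μ) →L[ℝ] Lp ℝ 2 (fermiCurveMeasure (squareDispersion 1 0) μ))
      (V : Submodule ℝ (Lp ℝ 2 (fermiCurveMeasure (squareDispersion 1 0) μ))) (T : V →L[ℝ] V) (x : V) (l : ℝ),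
      -- the sector
      (∀ v, v ∈ V ↔ P v = v) ∧ CompleteSpace V ∧
      -- the operators
      (∀ φ : Lp ℝ 2 (fermiCurveMeasure (squareDispersion 1 0) μ),
        (A φ : Momentum → ℝ) =ᵐ[fermiCurveMeasure (squareDispersion 1 0) μ]
          fun k => ∫ k', ((if withU then 1 else 0) + lindhardFunction (squareDispersion 1 0) μ (k + k')) * φ k'
            ∂fermiCurveMeasure (squareDispersion 1 0) μ) ∧
      (∀ φ ψ : Lp ℝ 2 (fermiCurveMeasure (squareDispersion 1 0) μ),
        inner ℝ ψ (A φ) = ∫ k, ψ k * ∫ k', ((if withU then 1 else 0) +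
            lindhardFunction (squareDispersion 1 0) μ (k + k')) * φ k'
          ∂fermiCurveMeasure (squareDispersion 1 0) μ ∂fermiCurveMeasure (squareDispersion 1 0) μ) ∧
      IsSelfAdjoint A ∧ IsCompactOperator A ∧ A * P = P * A ∧
      (∀ (ψ : Momentum → ℝ) (hψ : MemLp ψ 2 (fermiCurveMeasure (squareDispersion 1 0) μ)),
        InChannel χ ψ → P (hψ.toLp ψ) = hψ.toLp ψ) ∧
      (∀ φ : Lp ℝ 2 (fermiCurveMeasure (squareDispersion 1 0) μ), P φ = φ →
        ∃ ψ : Momentum → ℝ, InChannel χ ψ ∧ MemLp ψ 2 (fermiCurveMeasure (squareDispersion 1 0) μ) ∧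
          (φ : Momentum → ℝ) =ᵐ[fermiCurveMeasure (squareDispersion 1 0) μ] ψ) ∧
      (∀ φ : Lp ℝ 2 (fermiCurveMeasure (squareDispersion 1 0) μ),
        (U₁ φ : Momentum → ℝ) =ᵐ[fermiCurveMeasure (squareDispersion 1 0) μ] fun k => φ (rotMomentum k)) ∧
      A * U₁ = U₁ * A ∧ P * U₁ = U₁ * P ∧
      (∀ φ ψ : Lp ℝ 2 (fermiCurveMeasure (squareDispersion 1 0) μ), inner ℝ (U₁ φ) (U₁ ψ) = inner ℝ φ ψ) ∧
      (χ = D4Irrep.E → ∀ v : Lp ℝ 2 (fermiCurveMeasure (squareDispersion 1 0) μ), P v = v → inner ℝ v (U₁ v) = 0) ∧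
      -- the compression and the trial vector
      (∀ v, (T v : Lp ℝ 2 (fermiCurveMeasure (squareDispersion 1 0) μ)) = A v) ∧
      ‖x‖ = 1 ∧
      (x : Lp ℝ 2 (fermiCurveMeasure (squareDispersion 1 0) μ)) =
        (Real.sqrt (∫ k, Φ k ^ 2 ∂fermiCurveMeasure (squareDispersion 1 0) μ))⁻¹ • hΦ.toLp Φ ∧
      -- the bottom eigenvalue and the Temple / Kato / multiplicity conclusions
      (∃ v, v ≠ 0 ∧ T v = l • v) ∧ l ≤ ρhi ∧
      min ((β * ρlo - ρlo ^ 2 - et) / (β - ρlo)) ((β * ρhi - ρhi ^ 2 - et) / (β - ρhi)) ≤ l ∧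
      (∀ y, l * ‖y‖ ^ 2 ≤ inner ℝ y (T y)) ∧
      (∀ (c' : ℝ) (v), v ≠ 0 → T v = c' • v → c' = l ∨ β ≤ c') ∧
      (∃ v, T v = l • v ∧ ‖x - v‖ ^ 2 ≤ et / (β - ρhi) ^ 2) ∧
      (∀ (m : ℕ) (w : Fin m → V), Orthonormal ℝ w → (∀ j, T (w j) = l • w j) → (m : ℝ) * ρhi ^ 2 ≤ h) := by
  haveI : IsFiniteMeasure (fermiCurveMeasure (squareDispersion 1 0) μ) :=
    stub_klFiniteMeasure stub_klGradient stub_klHausdorffFinite μ hμ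
  obtain ⟨A, P, U₁, hA, hAinner, hAsa, hAc, hAP, hPP, hPsa, hPae, hPfix, hPrepr, hU₁ae, hAU, hPU, hUinner, hEskew,
    hHS, hBpos⟩ := stub_klChannelOps μ hμ χ withU M c u hu hU hc
  -- the sector and the compression
  obtain ⟨V, hmemV, hVc⟩ : ∃ V : Submodule ℝ (Lp ℝ 2 (fermiCurveMeasure (squareDispersion 1 0) μ)),
      (∀ v, v ∈ V ↔ P v = v) ∧ CompleteSpace V :=
    ⟨_, fun v => kl_cb_mem_ker_iff P v, (ContinuousLinearMap.isClosed_ker _).completeSpace_coe⟩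
  haveI : CompleteSpace V := hVc
  have hVA : ∀ v ∈ V, A v ∈ V := by
    intro v hv
    rw [hmemV] at hv ⊢
    have h1 := congrArg (fun f => f v) hAP
    simp only [mul_apply_eq_comp] at h1
    rw [hv] at h1
    exact h1.symm
  obtain ⟨T, hT, hTsa', hTc'⟩ := exists_compression A V hVA
  have hTsa := hTsa' hAsa
  have hTc := hTc' hAc
  -- the trial vector
  have hx₀ae : (hΦ.toLp Φ : Momentum → ℝ) =ᵐ[fermiCurveMeasure (squareDispersion 1 0) μ] Φ := hΦ.coeFn_toLp
  have hx₀V : hΦ.toLp Φ ∈ V := (hmemV _).2 (hPfix Φ hΦ hΦch)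
  have hx₀norm : ‖hΦ.toLp Φ‖ ^ 2 = ∫ k, Φ k ^ 2 ∂fermiCurveMeasure (squareDispersion 1 0) μ :=
    kl_bs_norm_sq_eq_integral_of_ae_eq hx₀ae
  have hsqrtN : 0 < Real.sqrt (∫ k, Φ k ^ 2 ∂fermiCurveMeasure (squareDispersion 1 0) μ) := Real.sqrt_pos.2 hN
  have hxHnorm : ‖(Real.sqrt (∫ k, Φ k ^ 2 ∂fermiCurveMeasure (squareDispersion 1 0) μ))⁻¹ • hΦ.toLp Φ‖ = 1 := by
    rw [norm_smul, Real.norm_eq_abs, abs_of_pos (inv_pos.2 hsqrtN)]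
    have : ‖hΦ.toLp Φ‖ = Real.sqrt (∫ k, Φ k ^ 2 ∂fermiCurveMeasure (squareDispersion 1 0) μ) := by
      rw [← Real.sqrt_sq (norm_nonneg (hΦ.toLp Φ)), hx₀norm]
    rw [this, inv_mul_cancel₀ hsqrtN.ne']
  obtain ⟨x, hxnorm, hxdef⟩ : ∃ x : V, ‖x‖ = 1 ∧ (x : Lp ℝ 2 (fermiCurveMeasure (squareDispersion 1 0) μ)) =
      (Real.sqrt (∫ k, Φ k ^ 2 ∂fermiCurveMeasure (squareDispersion 1 0) μ))⁻¹ • hΦ.toLp Φ :=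
    ⟨⟨_, V.smul_mem _ hx₀V⟩, hxHnorm, rfl⟩
  -- Rayleigh quotient and residual of the trial vector
  have hinner₀ : inner ℝ (hΦ.toLp Φ) (A (hΦ.toLp Φ)) = ∫ k, Φ k * ∫ k', ((if withU then 1 else 0) +
      lindhardFunction (squareDispersion 1 0) μ (k + k')) * Φ k'
        ∂fermiCurveMeasure (squareDispersion 1 0) μ ∂fermiCurveMeasure (squareDispersion 1 0) μ :=
    kl_bs_inner_eq_of_ae_eq (fun q => (if withU then 1 else 0) + lindhardFunction (squareDispersion 1 0) μ q) A
      hAinner hx₀ae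
  have hρ : inner ℝ x (T x) = (∫ k, Φ k ^ 2 ∂fermiCurveMeasure (squareDispersion 1 0) μ)⁻¹ *
      inner ℝ (hΦ.toLp Φ) (A (hΦ.toLp Φ)) := by
    rw [(compression_inner_norm hT x).1, hxdef, map_smul, real_inner_smul_left, real_inner_smul_right, ← mul_assoc,
      ← mul_inv, Real.mul_self_sqrt hN.le]
  have hρlo' : ρlo ≤ inner ℝ x (T x) := by
    rw [hρ, hinner₀, le_inv_mul_iff₀ hN]; linarith
  have hρhi' : inner ℝ x (T x) ≤ ρhi := by
    rw [hρ, hinner₀, inv_mul_le_iff₀ hN]; linarith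
  have hAx₀ae : (A (hΦ.toLp Φ) : Momentum → ℝ) =ᵐ[fermiCurveMeasure (squareDispersion 1 0) μ] fun k =>
      ∫ k', ((if withU then 1 else 0) + lindhardFunction (squareDispersion 1 0) μ (k + k')) * Φ k'
        ∂fermiCurveMeasure (squareDispersion 1 0) μ := by
    filter_upwards [hA (hΦ.toLp Φ)] with k hk
    rw [hk]
    exact kl_bs_kernelIntegral_congr (fun q => (if withU then 1 else 0) + lindhardFunction (squareDispersion 1 0) μ q)
      hx₀ae k
  have hRae : ((A (hΦ.toLp Φ) - s • hΦ.toLp Φ : Lp ℝ 2 (fermiCurveMeasure (squareDispersion 1 0) μ)) : Momentum → ℝ)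
      =ᵐ[fermiCurveMeasure (squareDispersion 1 0) μ] fun k =>
        ∫ k', ((if withU then 1 else 0) + lindhardFunction (squareDispersion 1 0) μ (k + k')) * Φ k'
          ∂fermiCurveMeasure (squareDispersion 1 0) μ - s * Φ k := by
    filter_upwards [Lp.coeFn_sub (A (hΦ.toLp Φ)) (s • hΦ.toLp Φ), Lp.coeFn_smul s (hΦ.toLp Φ), hAx₀ae, hx₀ae]
      with k hk1 hk2 hk3 hk4
    rw [hk1, Pi.sub_apply, hk2, Pi.smul_apply, hk3, hk4, smul_eq_mul]
  have hresx : ‖T x - (s : ℝ) • x‖ ^ 2 ≤ et := by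
    have h1 : ((T x - s • x : V) : Lp ℝ 2 (fermiCurveMeasure (squareDispersion 1 0) μ)) =
        (Real.sqrt (∫ k, Φ k ^ 2 ∂fermiCurveMeasure (squareDispersion 1 0) μ))⁻¹ • (A (hΦ.toLp Φ) - s • hΦ.toLp Φ) := by
      rw [Submodule.coe_sub, Submodule.coe_smul, hT, hxdef, map_smul, smul_sub, smul_comm s]
    rw [← Submodule.norm_coe, h1, norm_smul, mul_pow, Real.norm_eq_abs, abs_of_pos (inv_pos.2 hsqrtN), inv_pow,
      Real.sq_sqrt hN.le, kl_bs_norm_sq_eq_integral_of_ae_eq hRae, inv_mul_le_iff₀ hN]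
    linarith
  -- multiplicity
  obtain ⟨d, hd, hdcast, hdE, hdnE⟩ : ∃ d : ℕ, 1 ≤ d ∧ (d : ℝ) = (if χ = D4Irrep.E then 2 else 1 : ℝ) ∧
      (χ = D4Irrep.E → d = 2) ∧ (χ ≠ D4Irrep.E → d = 1) := by
    by_cases hE : χ = D4Irrep.E
    · exact ⟨2, by norm_num, by rw [if_pos hE]; norm_num, fun _ => rfl, fun h => absurd hE h⟩
    · exact ⟨1, le_rfl, by rw [if_neg hE]; norm_num, fun h => absurd h hE, fun _ => rfl⟩
  have hmult : ∀ (c' : ℝ) (v : V), c' < 0 → v ≠ 0 → T v = (c' : ℝ) • v →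
      ∃ w : Fin d → V, Orthonormal ℝ w ∧ ∀ j, T (w j) = (c' : ℝ) • w j := by
    by_cases hE : χ = D4Irrep.E
    · rw [hdE hE]
      have hUV : ∀ v ∈ V, U₁ v ∈ V := by
        intro v hv
        rw [hmemV] at hv ⊢
        have h1 := congrArg (fun f => f v) hPU
        simp only [mul_apply_eq_comp] at h1
        rw [hv] at h1
        exact h1
      have horth : ∀ v ∈ V, inner ℝ v (U₁ v) = 0 := fun v hv => hEskew hE v ((hmemV v).1 hv)
      exact doublet_of_isometry (𝕜 := ℝ) hT hAU hUV hUinner horth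
    · rw [hdnE hE]
      intro c' v _ hv hTv
      have hvn : ‖(v : Lp ℝ 2 (fermiCurveMeasure (squareDispersion 1 0) μ))‖ ≠ 0 := by
        rw [Submodule.norm_coe]; exact norm_ne_zero_iff.2 hv
      refine ⟨![(‖(v : Lp ℝ 2 (fermiCurveMeasure (squareDispersion 1 0) μ))‖⁻¹ : ℝ) • v], ?_, ?_⟩
      · rw [orthonormal_iff_ite]
        intro i j
        fin_cases i; fin_cases j
        simp only [Fin.zero_eta, Fin.isValue, Matrix.cons_val_fin_one, ↓reduceIte]
        rw [Submodule.coe_inner, Submodule.coe_smul, real_inner_smul_left, real_inner_smul_right,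
          real_inner_self_eq_norm_sq]
        field_simp
      · intro j
        fin_cases j
        simp only [Fin.zero_eta, Fin.isValue, Matrix.cons_val_fin_one, map_smul, hTv]
        rw [smul_comm]
  -- negative square mass
  have hfam : ∀ (m : ℕ) (f : Fin m → Lp ℝ 2 (fermiCurveMeasure (squareDispersion 1 0) μ)), Orthonormal ℝ f →
      (∀ j, f j ∈ V) →
      ∑ j, ‖A (f j) - (∑ m, c m • (innerSL ℝ ((hu m).toLp (u m))).smulRight ((hu m).toLp (u m))) (f j)‖ ^ 2 ≤ h :=
    fun m f hf hfV => (hHS m f hf fun j => (hmemV _).1 (hfV j)).trans hH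
  have hsq := negSqMass_le_of_family_bound (𝕜 := ℝ) hT (fun y => by simpa using hBpos y) hfam
  -- Temple
  have hβ' : h - d * ρhi ^ 2 ≤ β ^ 2 := by rw [hdcast]; exact hβ
  obtain ⟨l, hl, hlρ, hLl, hray, hgap, hkato, hmass⟩ :=
    temple_certificate_residual (𝕜 := ℝ) hTc hTsa hd hmult hsq hxnorm (by simpa using hρlo') (by simpa using hρhi')
      hρhi0 hresx hβ0 hβ' hρβ
  refine ⟨A, P, U₁, V, T, x, l, hmemV, hVc, hA, hAinner, hAsa, hAc, hAP, hPfix, hPrepr, hU₁ae, hAU, hPU, hUinner, hEskew, hT,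
    hxnorm, hxdef, ?_, hlρ, hLl, fun y => by simpa using hray y, ?_, ?_, hmass⟩
  · obtain ⟨v, hv, hTv⟩ := hl
    exact ⟨v, hv, by simpa using hTv⟩
  · intro c' v hv hTv
    exact hgap c' v hv (by simpa using hTv)
  · obtain ⟨v, hTv, hdist⟩ := hkato
    exact ⟨v, by simpa using hTv, hdist⟩

/-! ### The stub: bounds for the channel bottom -/

set_option maxHeartbeats 400000 in
/-- **Certified bounds for one channel bottom, residual form** (`stub_klChannelBoundR`): under the enclosure hypotheses
of `kl_cbr_setup` (residual bound `∫ (∫ κ Φ - s Φ)² ≤ et ∫ Φ²`),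
`min ((βρlo - ρlo² - et)/(β - ρlo)) ((βρhi - ρhi² - et)/(β - ρhi)) ≤ channelInf ε₀ μ 1 χ`, and `channelInf ε₀ μ 1 χ ≤ ρhi`
unless `χ = A1g` without the bare-`U` term (Ritz with the normalised trial; Temple via `temple_certificate_residual`;
Rayleigh quotients of `P`-fixed unit vectors are pairing forms of channel states). [cite: ReedSimonIV1978, Thm. XIII.5] -/
theorem stub_klChannelBoundR : ∀ μ ∈ Set.Ioo (-4 : ℝ) 0, ∀ (χ : D4Irrep) (withU : Bool) (M : ℕ) (c : Fin M → ℝ)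
    (u : Fin M → Momentum → ℝ) (Φ : Momentum → ℝ) (ρlo ρhi et h β s : ℝ),
    (withU = true → χ = D4Irrep.A1g) → (∀ m, 0 ≤ c m) →
    (∀ m, MemLp (u m) 2 (fermiCurveMeasure (squareDispersion 1 0) μ)) →
    MemLp Φ 2 (fermiCurveMeasure (squareDispersion 1 0) μ) → InChannel χ Φ →
    0 < ∫ k, Φ k ^ 2 ∂fermiCurveMeasure (squareDispersion 1 0) μ →
    ρlo * ∫ k, Φ k ^ 2 ∂fermiCurveMeasure (squareDispersion 1 0) μ ≤
      ∫ k, Φ k * ∫ k', ((if withU then 1 else 0) + lindhardFunction (squareDispersion 1 0) μ (k + k')) * Φ k'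
        ∂fermiCurveMeasure (squareDispersion 1 0) μ ∂fermiCurveMeasure (squareDispersion 1 0) μ →
    ∫ k, Φ k * ∫ k', ((if withU then 1 else 0) + lindhardFunction (squareDispersion 1 0) μ (k + k')) * Φ k'
        ∂fermiCurveMeasure (squareDispersion 1 0) μ ∂fermiCurveMeasure (squareDispersion 1 0) μ ≤
      ρhi * ∫ k, Φ k ^ 2 ∂fermiCurveMeasure (squareDispersion 1 0) μ →
    ρhi < 0 →
    ∫ k, (∫ k', ((if withU then 1 else 0) + lindhardFunction (squareDispersion 1 0) μ (k + k')) * Φ k'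
        ∂fermiCurveMeasure (squareDispersion 1 0) μ - s * Φ k) ^ 2 ∂fermiCurveMeasure (squareDispersion 1 0) μ ≤
      et * ∫ k, Φ k ^ 2 ∂fermiCurveMeasure (squareDispersion 1 0) μ →
    ∫ z, (d4Project χ (fun q => (if withU then 1 else 0) + lindhardFunction (squareDispersion 1 0) μ (z.1 + q)) z.2 -
        ∑ m, c m * (u m z.1 * u m z.2)) ^ 2
        ∂(fermiCurveMeasure (squareDispersion 1 0) μ).prod (fermiCurveMeasure (squareDispersion 1 0) μ) ≤ h →
    β ≤ 0 → h - (if χ = D4Irrep.E then 2 else 1) * ρhi ^ 2 ≤ β ^ 2 → ρhi < β →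
    min ((β * ρlo - ρlo ^ 2 - et) / (β - ρlo)) ((β * ρhi - ρhi ^ 2 - et) / (β - ρhi)) ≤ channelInf (squareDispersion 1 0) μ 1 χ ∧
    ((withU = true ∨ χ ≠ D4Irrep.A1g) → channelInf (squareDispersion 1 0) μ 1 χ ≤ ρhi) := by
  intro μ hμ χ withU M c u Φ ρlo ρhi et h β s hU hc hu hΦ hΦch hN hρlo hρhi hρhi0 hres hH hβ0 hβ hρβ
  -- a derived `MemLp` proof for each `u m` so that the operators of the setup are well defined
  obtain ⟨A, P, U₁, V, T, x, l, hmemV, -, hA, hAinner, -, -, -, hPfix, hPrepr, -, -, -, -, -, hT, hxnorm, hxdef, -, hlρ, hLl,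
    hray, -, -, -⟩ := kl_cbr_setup hμ χ withU hU hu hc hΦ hΦch hN hρlo hρhi hρhi0 hres hH hβ0 hβ hρβ
  -- every channel state has pairing form `≥ l`
  have hlow : ∀ ψ, IsChannelState (squareDispersion 1 0) μ χ ψ →
      l ≤ pairingForm (squareDispersion 1 0) μ 1 ψ := by
    intro ψ hψ
    have hvae : (hψ.1.toLp ψ : Momentum → ℝ) =ᵐ[fermiCurveMeasure (squareDispersion 1 0) μ] ψ := hψ.1.coeFn_toLp
    have hvV : P (hψ.1.toLp ψ) = hψ.1.toLp ψ := hPfix ψ hψ.1 hψ.2.2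
    have hvnorm : ‖hψ.1.toLp ψ‖ = 1 := by
      have h2 : ‖hψ.1.toLp ψ‖ ^ 2 = 1 := by rw [kl_bs_norm_sq_eq_integral_of_ae_eq hvae, hψ.2.1]
      exact (pow_eq_one_iff_of_nonneg (norm_nonneg _) two_ne_zero).1 h2
    have h1 := hray ⟨hψ.1.toLp ψ, (hmemV _).2 hvV⟩
    rw [(compression_inner_norm hT _).1] at h1
    change l * ‖hψ.1.toLp ψ‖ ^ 2 ≤ inner ℝ (hψ.1.toLp ψ) (A (hψ.1.toLp ψ)) at h1
    rw [hvnorm, one_pow, mul_one, kl_bs_inner_eq_of_ae_eq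
      (fun q => (if withU then 1 else 0) + lindhardFunction (squareDispersion 1 0) μ q) A hAinner hvae] at h1
    exact h1.trans (kl_cb_pairingForm_ge hμ hU hψ).1
  have hne : ((pairingForm (squareDispersion 1 0) μ 1) '' {ψ | IsChannelState (squareDispersion 1 0) μ χ ψ}).Nonempty :=
    (nonempty_isChannelState hμ.1 hμ.2 χ).image _
  have hbdd : BddBelow ((pairingForm (squareDispersion 1 0) μ 1) '' {ψ | IsChannelState (squareDispersion 1 0) μ χ ψ}) :=
    ⟨l, by rintro r ⟨ψ, hψ, rfl⟩; exact hlow ψ hψ⟩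
  refine ⟨hLl.trans (le_csInf hne (by rintro r ⟨ψ, hψ, rfl⟩; exact hlow ψ hψ)), fun hcase => ?_⟩
  -- the upper bound from the representative of the trial vector
  have hxfix : P (x : Lp ℝ 2 (fermiCurveMeasure (squareDispersion 1 0) μ)) = x := (hmemV _).1 x.2
  obtain ⟨ψ, hch, hmem, hae⟩ := hPrepr _ hxfix
  have hnorm1 : ‖(x : Lp ℝ 2 (fermiCurveMeasure (squareDispersion 1 0) μ))‖ = 1 := hxnorm
  have hstate : IsChannelState (squareDispersion 1 0) μ χ ψ :=
    ⟨hmem, by rw [← kl_bs_norm_sq_eq_integral_of_ae_eq hae, hnorm1, one_pow], hch⟩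
  have hval : pairingForm (squareDispersion 1 0) μ 1 ψ = inner ℝ x (T x) := by
    rw [(kl_cb_pairingForm_ge hμ hU hstate).2 hcase, (compression_inner_norm hT x).1,
      kl_bs_inner_eq_of_ae_eq (fun q => (if withU then 1 else 0) + lindhardFunction (squareDispersion 1 0) μ q) A
        hAinner hae]
  have hρx : inner ℝ x (T x) ≤ ρhi := by
    -- `inner x (T x) = Q/N ≤ ρhi`: recomputed from the explicit form of `x`
    have hinner₀ := kl_bs_inner_eq_of_ae_eq (fun q => (if withU then 1 else 0) + lindhardFunction (squareDispersion 1 0) μ q)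
      A hAinner (hΦ.coeFn_toLp)
    have hsqrtN : 0 < Real.sqrt (∫ k, Φ k ^ 2 ∂fermiCurveMeasure (squareDispersion 1 0) μ) := Real.sqrt_pos.2 hN
    rw [(compression_inner_norm hT x).1, hxdef, map_smul, real_inner_smul_left, real_inner_smul_right, ← mul_assoc,
      ← mul_inv, Real.mul_self_sqrt hN.le, hinner₀, inv_mul_le_iff₀ hN]
    linarith
  calc channelInf (squareDispersion 1 0) μ 1 χ ≤ pairingForm (squareDispersion 1 0) μ 1 ψ :=
        csInf_le hbdd ⟨ψ, hstate, rfl⟩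
    _ ≤ ρhi := hval ▸ hρx

end Summit.HubbardSuperconductivity.HubbardSuperconductivity.Theorems

end
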